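import Summits.CriticalPhenomena.CardyFormulaZ2.Theorems.CardyComplexConeEdgePrecompactResponseStabilityReduction
import Summits.CriticalPhenomena.CardyFormulaZ2.Theorems.CardyComplexConeEdgePrecompactUniformForwardResponseStability

/-!
# Response stability from its uniform single-datum forward form (composition)
(line `qkz-strip-boundary-arm` of crux `CardyComplexCone.EdgePrecompact`, stmt-CriticalPhenomena-11387)

The one-line composition of `forwardResponseStability_of_uniformForwardResponseStability`
(`…EdgePrecompactUniformForwardResponseStability.lean`, which carries the road map for the uniform forward
statement "UFRS") with `responseStability_of_forwardResponseStability`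
(`…EdgePrecompactResponseStabilityReduction.lean`): UFRS implies the registered stub
`stub_responseStability` verbatim. Registered sub-goal `responseStability_of_uniformForwardResponseStability`.

References: S. Smirnov, C. R. Acad. Sci. Paris 333 (2001), §2; G. Grimmett, *Percolation* (1999), §1.6, §11.2.
-/

namespace Summit.CriticalPhenomena.CardyFormulaZ2.Cruxes.EdgePrecompact.QkzStripBoundaryArm

open MeasureTheory Filter Set Metric
open scoped Topology BigOperators Pointwise
open Literature.Probability.LatticeModels Literature.Probability.Percolation
open Literature.Probability.RandomPlanarGeometry (DobrushinDomain)
open Summit.CriticalPhenomena.CardyFormulaZ2.Theses.CardyComplexCone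

noncomputable section

/-- **Response stability from uniform single-datum forward response stability** (registered
sub-goal `responseStability_of_uniformForwardResponseStability` of stmt-CriticalPhenomena-11387): the
composition of `forwardResponseStability_of_uniformForwardResponseStability` with
`responseStability_of_forwardResponseStability`. HYPOTHESIS: UFRS (module docstring of
`…EdgePrecompactUniformForwardResponseStability.lean`). CONCLUSION: the statement of
`stub_responseStability`, verbatim. -/
theorem responseStability_of_uniformForwardResponseStability : (∀ (D : DobrushinDomain) (K : Set ℂ), IsCompact K → K ⊆ D.carrier → ∀ ρ > (0:ℝ), cthickening (2 * ρ) K ⊆ D.carrier → ∀ ε > (0:ℝ), ∃ η > (0:ℝ), ∃ δ₀ > (0:ℝ), ∀ E : DiscreteDobrushin, E.Ω = D.carrier → E.IsZdAdmissible → E.δ < δ₀ → ∀ v w : Site 2, meshPoint E.δ v ∈ K → ‖meshPoint E.δ w‖ < η → (bondPercolation (zdGraph 2) half).real {ω : BondConfig (Site 2) | ¬ ∀ a a' : Site 2 × Fin 4, ((E.IsStartCorner a ∧ (shiftData E w).IsStartCorner a') ∨ (a = a' ∧ medialPoint E.δ (cSrc a) ∈ ball (meshPoint E.δ v) ρ ∧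 medialPoint E.δ (cTgt a) ∉ ball (meshPoint E.δ v) ρ)) → ∀ n : ℕ, (∀ i < n, medialPoint E.δ (cTgt (cornerOrbit (E.bcBondConfig ω) a i)) ∉ ball (meshPoint E.δ v) ρ ∧ E.IsInnerFace (cFace (cornerOrbit (E.bcBondConfig ω) a (i + 1)))) → medialPoint E.δ (cTgt (cornerOrbit (E.bcBondConfig ω) a n)) ∈ ball (meshPoint E.δ v) ρ → ∃ n' : ℕ, (∀ i < n', medialPoint E.δ (cTgt (cornerOrbit ((shiftData E w).bcBondConfig ω) a' i)) ∉ ball (meshPoint E.δ v) ρ ∧ (shiftData E w).IsInnerFace (cFace (cornerOrbit ((shiftData E w).bcBondConfig ω) a' (i + 1)))) ∧ cornerOrbit ((shiftData E w).bcBondConfig ω) a' n' = cornerOrbit (E.bcBondConfig ω) a n ∧ ∑ i ∈ Finset.range n', turnOf ((shiftData E w).bcBondConfig ω) (cornerOrbit ((shiftData E w).bcBondConfig ω) a' i) = ∑ i ∈ Finset.range n, turnOf (E.bcBondConfig ω) (cornerOrbit (E.bcBondConfig ω) a i)} ≤ ε) → ∀ (D : DobrushinDomain) (Λ : ℝ →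 DiscreteDobrushin), (∀ δ, (Λ δ).Ω = D.carrier) → (∀ δ, (Λ δ).δ = δ) → (∀ᶠ δ in nhdsWithin (0:ℝ) (Set.Ioi 0), (Λ δ).IsZdAdmissible) → ∀ K : Set ℂ, IsCompact K → K ⊆ D.carrier → ∀ ρ > (0:ℝ), cthickening (2 * ρ) K ⊆ D.carrier → ∀ ε > (0:ℝ), ∃ η > (0:ℝ), ∀ᶠ δ in nhdsWithin (0:ℝ) (Set.Ioi 0), ∀ v f w : Site 2, IsCorner v f → meshPoint δ v ∈ K → ‖meshPoint δ w‖ < η → (bondPercolation (zdGraph 2) half).real {ω : BondConfig (Site 2) | ¬ ∀ a a' : Site 2 × Fin 4, (((Λ δ).IsStartCorner a ∧ (shiftData (Λ δ) w).IsStartCorner a') ∨ (a = a' ∧ medialPoint δ (cSrc a) ∈ ball (meshPoint δ v) ρ ∧ medialPoint δ (cTgt a) ∉ ball (meshPoint δ v) ρ)) → (∀ n : ℕ, (∀ i < n, medialPoint δ (cTgt (cornerOrbit ((Λ δ).bcBondConfig ω) a i)) ∉ ball (meshPoint δ v) ρ ∧ (Λ δ).IsInnerFace (cFace (cornerOrbit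 ((Λ δ).bcBondConfig ω) a (i + 1)))) → medialPoint δ (cTgt (cornerOrbit ((Λ δ).bcBondConfig ω) a n)) ∈ ball (meshPoint δ v) ρ → ∃ n' : ℕ, (∀ i < n', medialPoint δ (cTgt (cornerOrbit ((shiftData (Λ δ) w).bcBondConfig ω) a' i)) ∉ ball (meshPoint δ v) ρ ∧ (shiftData (Λ δ) w).IsInnerFace (cFace (cornerOrbit ((shiftData (Λ δ) w).bcBondConfig ω) a' (i + 1)))) ∧ cornerOrbit ((shiftData (Λ δ) w).bcBondConfig ω) a' n' = cornerOrbit ((Λ δ).bcBondConfig ω) a n ∧ ∑ i ∈ Finset.range n', turnOf ((shiftData (Λ δ) w).bcBondConfig ω) (cornerOrbit ((shiftData (Λ δ) w).bcBondConfig ω) a' i) = ∑ i ∈ Finset.range n, turnOf ((Λ δ).bcBondConfig ω) (cornerOrbit ((Λ δ).bcBondConfig ω) a i)) ∧ (∀ n : ℕ, (∀ i < n, medialPoint δ (cTgt (cornerOrbit ((shiftData (Λ δ) w).bcBondConfig ω) a' i)) ∉ ball (meshPoint δ v) ρ ∧ (shiftData (Λ δ) w).IsInnerFace (cFace (cornerOrbit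 ((shiftData (Λ δ) w).bcBondConfig ω) a' (i + 1)))) → medialPoint δ (cTgt (cornerOrbit ((shiftData (Λ δ) w).bcBondConfig ω) a' n)) ∈ ball (meshPoint δ v) ρ → ∃ n' : ℕ, (∀ i < n', medialPoint δ (cTgt (cornerOrbit ((Λ δ).bcBondConfig ω) a i)) ∉ ball (meshPoint δ v) ρ ∧ (Λ δ).IsInnerFace (cFace (cornerOrbit ((Λ δ).bcBondConfig ω) a (i + 1)))) ∧ cornerOrbit ((Λ δ).bcBondConfig ω) a n' = cornerOrbit ((shiftData (Λ δ) w).bcBondConfig ω) a' n ∧ ∑ i ∈ Finset.range n', turnOf ((Λ δ).bcBondConfig ω) (cornerOrbit ((Λ δ).bcBondConfig ω) a i) = ∑ i ∈ Finset.range n, turnOf ((shiftData (Λ δ) w).bcBondConfig ω) (cornerOrbit ((shiftData (Λ δ) w).bcBondConfig ω) a' i))} ≤ ε :=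
  fun hU => responseStability_of_forwardResponseStability
    (forwardResponseStability_of_uniformForwardResponseStability hU)

end

end Summit.CriticalPhenomena.CardyFormulaZ2.Cruxes.EdgePrecompact.QkzStripBoundaryArm
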